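/-
Copyright (c) 2026. Released under the Apache 2.0 license.
-/
import Literature.NumberTheory.EllipticCurves.KrausConditionsIntegralModel
import HarnessLib

/-!
# Kraus's conditions are NECESSARY AND SUFFICIENT: proofs over `ℤ` (Kraus 1989, Props. 1–2; Tate's formulaire; Cremona §3.2)

Sibling of `KrausConditionsIntegralModel.lean` (the named fact `exists_integralWeierstrass_iff_krausConditions`,
Fisher 2007 Thm. 2.8 ⟸ Kraus 1989).  Here the NECESSITY half is PROVED for every `W : WeierstrassCurve ℤ`, directly
from Tate's formulaire `c₄ = b₂² − 24b₄`, `c₆ = −b₂³ + 36b₂b₄ − 216b₆`, `b₂ = a₁² + 4a₂`, `b₄ = 2a₄ + a₁a₃`,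
`b₆ = a₃² + 4a₆` (Fisher, loc. cit.: "the necessity of these conditions is immediate from Tate's formulaire"), in the
sharper form that records the parity of `c₄` on each branch, together with the refinement used by the cell
bsd-f2-manin (es g34, THEOREM 55.H (i)): `2 ∣ c₄ ∧ 2 ∣ Δ ⟹ 16 ∣ c₄ ∧ 32 ∣ c₆` (the branch `a₁` even, `a₃` odd has
odd `Δ`).  No new `Prop` is introduced.  The SUFFICIENCY half (Kraus's Props. 1–2 read constructively; Cremona §3.2, the
Laska–Kraus–Connell reconstruction of `a₁, …, a₆` from `c₄, c₆`) is proved in the second part of the file, and the named fact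
is DISCHARGED: `exists_integralWeierstrass_iff_krausConditions_holds`.

## Main statements

* `kraus_two_of_int W : (¬ 2 ∣ c₄ ∧ c₆ ≡ −1 [ZMOD 4]) ∨ (16 ∣ c₄ ∧ (c₆ ≡ 0 [ZMOD 32] ∨ c₆ ≡ 8 [ZMOD 32]))`;
* `padicValInt_three_c₆_ne_two W : padicValInt 3 c₆ ≠ 2`;
* `krausConditions_of_int W : KrausConditions W.c₄ W.c₆` (Kraus's conditions hold for every integer model);
* `sixteen_dvd_c₄_and_dvd_c₆_of_two_dvd W : 2 ∣ c₄ → 2 ∣ Δ → 16 ∣ c₄ ∧ 32 ∣ c₆`;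
* `KrausSufficiency.three_adic_root` (Prop. 1: a residue `t` mod `27` with `t² ≡ c₄ (3)`, `t³ − 3c₄t − 2c₆ ≡ 0 (27)`),
  `KrausSufficiency.two_adic_root_odd` (Prop. 2, branch `c₆ ≡ −1 (4)`: `t ≡ 1 (4)`, `t² ≡ c₄`, `t³ − 3c₄t − 2c₆ ≡ 0 (64)`),
  both from `KrausSufficiency.unit_root` (`t ≡ −c₆/c₄` when `c₄` is a unit: `c₄³(t³ − 3c₄t − 2c₆) ≡ c₆(c₄³ − c₆²)`);
* `exists_integralWeierstrass_of_krausConditions : 1728 ∣ c₄³ − c₆² → KrausConditions c₄ c₆ → ∃ W, W.c₄ = c₄ ∧ W.c₆ = c₆`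
  (CRT glue `b₂ ≡ t₂ (64)`, `b₂ ≡ t₃ (27)`; `a₄ = (b₂² − c₄)/48`, `a₆ = (b₂³ − 3c₄b₂ − 2c₆ − 432a₃)/1728`);
* `exists_integralWeierstrass_iff_krausConditions_holds : exists_integralWeierstrass_iff_krausConditions` (the discharge).

## References
* [Kraus1989] A. Kraus, Acta Arith. 54 (1989), Props. 1–2 (necessity).
* [Fisher2007MinimisingQuarticsCubics] T. Fisher, Math. Res. Lett. 14 (2007), Thm. 2.8 and the sentence after it.
* [SilvermanAEC2009] J. H. Silverman, AEC, III.1 (the quantities `b₂, b₄, b₆, b₈, c₄, c₆, Δ`).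
* [Cremona1997Algorithms] J. E. Cremona, Algorithms for modular elliptic curves, §3.2 (the Laska–Kraus–Connell algorithm,
  p. 51 of the held scan, lines 10–23: the test and the reconstruction `a₁ = c₄ mod 2`, …, `a₆ = (−b₂³ + 36b₂b₄ − c₆ − 216a₃²)/864`).
-/

namespace Literature.NumberTheory.EllipticCurves

namespace KrausNecessity

variable (W : WeierstrassCurve ℤ)

/-- Tate's formulaire: `c₄ = b₂² − 24b₄` (Mathlib's definition, `rfl`). [folklore] -/
private theorem c₄_eq : W.c₄ = W.b₂ ^ 2 - 24 * W.b₄ := rfl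

/-- Tate's formulaire: `c₆ = −b₂³ + 36b₂b₄ − 216b₆` (`rfl`). [folklore] -/
private theorem c₆_eq : W.c₆ = -W.b₂ ^ 3 + 36 * W.b₂ * W.b₄ - 216 * W.b₆ := rfl

/-- Tate's formulaire: `Δ = −b₂²b₈ − 8b₄³ − 27b₆² + 9b₂b₄b₆` (`rfl`). [folklore] -/
private theorem Δ_eq : W.Δ = -W.b₂ ^ 2 * W.b₈ - 8 * W.b₄ ^ 3 - 27 * W.b₆ ^ 2 + 9 * W.b₂ * W.b₄ * W.b₆ := rfl

/-- `a₁ = 2k ⟹ b₂ = 4(k² + a₂)`. [folklore] -/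
private theorem b₂_of_even {k : ℤ} (hk : W.a₁ = 2 * k) : W.b₂ = 4 * (k ^ 2 + W.a₂) := by
  simp only [WeierstrassCurve.b₂, hk]; ring

/-- `a₁ = 2k ⟹ b₄ = 2(a₄ + k a₃)`. [folklore] -/
private theorem b₄_of_even {k : ℤ} (hk : W.a₁ = 2 * k) : W.b₄ = 2 * (W.a₄ + k * W.a₃) := by
  simp only [WeierstrassCurve.b₄, hk]; ring

/-- `a₁ = 2k + 1 ⟹ b₂ = 4(k² + k + a₂) + 1`. [folklore] -/
private theorem b₂_of_odd {k : ℤ} (hk : W.a₁ = 2 * k + 1) : W.b₂ = 4 * (k ^ 2 + k + W.a₂) + 1 := by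
  simp only [WeierstrassCurve.b₂, hk]; ring

/-- `a₃ = 2j ⟹ b₆ = 4(j² + a₆)`. [folklore] -/
private theorem b₆_of_even {j : ℤ} (hj : W.a₃ = 2 * j) : W.b₆ = 4 * (j ^ 2 + W.a₆) := by
  simp only [WeierstrassCurve.b₆, hj]; ring

/-- `a₃ = 2j + 1 ⟹ b₆ = 4(j² + j + a₆) + 1`. [folklore] -/
private theorem b₆_of_odd {j : ℤ} (hj : W.a₃ = 2 * j + 1) : W.b₆ = 4 * (j ^ 2 + j + W.a₆) + 1 := by
  simp only [WeierstrassCurve.b₆, hj]; ring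

end KrausNecessity

open KrausNecessity

/-- **Kraus's condition at `2` is necessary, with the parity of `c₄`** (Kraus 1989, Prop. 2, necessity; Tate's
formulaire): for an INTEGER Weierstrass equation, either `a₁` is odd — then `c₄` is odd and `c₆ ≡ −1 (mod 4)` — or
`a₁` is even — then `16 ∣ c₄` and `c₆ ≡ 0 (mod 32)` (`a₃` even) or `c₆ ≡ 8 (mod 32)` (`a₃` odd).
[cite: Kraus1989, Prop. 2] [cite: Fisher2007MinimisingQuarticsCubics, Thm. 2.8 («necessity … immediate from Tate's formulaire»)] -/
theorem kraus_two_of_int (W : WeierstrassCurve ℤ) :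
    (¬ (2 : ℤ) ∣ W.c₄ ∧ W.c₆ ≡ -1 [ZMOD 4]) ∨
      ((16 : ℤ) ∣ W.c₄ ∧ (W.c₆ ≡ 0 [ZMOD 32] ∨ W.c₆ ≡ 8 [ZMOD 32])) := by
  obtain ⟨k, hk | hk⟩ := Int.even_or_odd' W.a₁
  · -- `a₁ = 2k`
    right
    have hb₂ := KrausNecessity.b₂_of_even W hk
    have hb₄ := KrausNecessity.b₄_of_even W hk
    refine ⟨⟨(k ^ 2 + W.a₂) ^ 2 - 3 * (W.a₄ + k * W.a₃), ?_⟩, ?_⟩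
    · rw [KrausNecessity.c₄_eq, hb₂, hb₄]; ring
    obtain ⟨j, hj | hj⟩ := Int.even_or_odd' W.a₃
    · left
      have hb₆ := KrausNecessity.b₆_of_even W hj
      refine Int.modEq_zero_iff_dvd.mpr ⟨-2 * (k ^ 2 + W.a₂) ^ 3 + 9 * (k ^ 2 + W.a₂) * (W.a₄ + k * W.a₃)
        - 27 * (j ^ 2 + W.a₆), ?_⟩
      rw [KrausNecessity.c₆_eq, hb₂, hb₄, hb₆]; ring
    · right
      have hb₆ := KrausNecessity.b₆_of_odd W hj
      refine Int.modEq_iff_dvd.mpr ⟨2 * (k ^ 2 + W.a₂) ^ 3 - 9 * (k ^ 2 + W.a₂) * (W.a₄ + k * W.a₃)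
        + 27 * (j ^ 2 + j + W.a₆) + 7, ?_⟩
      rw [KrausNecessity.c₆_eq, hb₂, hb₄, hb₆]; ring
  · -- `a₁ = 2k + 1`
    left
    have hb₂ := KrausNecessity.b₂_of_odd W hk
    refine ⟨?_, ?_⟩
    · rintro ⟨w, hw⟩
      have h := KrausNecessity.c₄_eq W
      rw [hb₂] at h
      have : W.c₄ = 2 * (8 * (k ^ 2 + k + W.a₂) ^ 2 + 4 * (k ^ 2 + k + W.a₂) - 12 * W.b₄) + 1 := by
        rw [h]; ring
      omega
    · refine Int.modEq_iff_dvd.mpr ⟨16 * (k ^ 2 + k + W.a₂) ^ 3 + 12 * (k ^ 2 + k + W.a₂) ^ 2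
        + 3 * (k ^ 2 + k + W.a₂) - 9 * (4 * (k ^ 2 + k + W.a₂) + 1) * W.b₄ + 54 * W.b₆, ?_⟩
      rw [KrausNecessity.c₆_eq, hb₂]; ring

/-- **Kraus's condition at `3` is necessary: `ord₃(c₆) ≠ 2`** (Kraus 1989, Prop. 1, necessity): writing
`b₂ = 3m + r`, `r ∈ {0, 1, 2}`: if `r = 0` then `27 ∣ c₆ = −27m³ + 108mb₄ − 216b₆`, else `c₆ ≡ −r³ ≢ 0 (mod 3)`.
[cite: Kraus1989, Prop. 1] [cite: Fisher2007MinimisingQuarticsCubics, Thm. 2.8 (i)] -/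
theorem padicValInt_three_c₆_ne_two (W : WeierstrassCurve ℤ) : padicValInt 3 W.c₆ ≠ 2 := by
  have hb : W.b₂ = 3 * (W.b₂ / 3) + W.b₂ % 3 := by omega
  set m := W.b₂ / 3
  set r := W.b₂ % 3
  have hr0 : 0 ≤ r := Int.emod_nonneg _ (by norm_num)
  have hr3 : r < 3 := Int.emod_lt_of_pos _ (by norm_num)
  have hc : W.c₆ = 3 * (-9 * m ^ 3 - 9 * m ^ 2 * r - 3 * m * r ^ 2 + 12 * (3 * m + r) * W.b₄ - 72 * W.b₆)
      - r ^ 3 := by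
    rw [KrausNecessity.c₆_eq, hb]; ring
  by_cases hr : r = 0
  · -- `27 ∣ c₆`
    have h27 : ((3 : ℕ) : ℤ) ^ 3 ∣ W.c₆ := by
      refine ⟨-m ^ 3 + 4 * m * W.b₄ - 8 * W.b₆, ?_⟩
      rw [KrausNecessity.c₆_eq, hb, hr]; push_cast; ring
    rcases (padicValInt_dvd_iff 3 W.c₆).mp h27 with h0 | h3
    · rw [h0, padicValInt.zero]; decide
    · omega
  · -- `3 ∤ c₆`
    have h3 : ¬ ((3 : ℕ) : ℤ) ∣ W.c₆ := by
      rintro ⟨w, hw⟩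
      rw [hc] at hw
      push_cast at hw
      have hr12 : r = 1 ∨ r = 2 := by omega
      rcases hr12 with h1 | h2
      · rw [h1] at hw; omega
      · rw [h2] at hw; omega
    rw [padicValInt.eq_zero_of_not_dvd h3]; decide

/-- **Every integer Weierstrass equation satisfies Kraus's conditions** (the necessity half of
`exists_integralWeierstrass_iff_krausConditions`, PROVED). [cite: Kraus1989, Props. 1–2]
[cite: Fisher2007MinimisingQuarticsCubics, Thm. 2.8] -/
theorem krausConditions_of_int (W : WeierstrassCurve ℤ) : KrausConditions W.c₄ W.c₆ :=
  ⟨padicValInt_three_c₆_ne_two W, (kraus_two_of_int W).imp (fun h => h.2) id⟩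

/-- **The additive refinement** (cell bsd-f2-manin, es THEOREM 55.H (i); Tate's formulaire): if `2 ∣ c₄` and `2 ∣ Δ`
for an integer Weierstrass equation — e.g. a `2`-minimal model with additive reduction at `2` — then `16 ∣ c₄` and
`32 ∣ c₆` (`a₁` must be even since `c₄` is even; `a₃` must be even since otherwise
`Δ = −b₂²b₈ − 8b₄³ − 27b₆² + 9b₂b₄b₆` is odd).  Hence `(c₄, −c₆)` again satisfies Kraus's conditions at `2`.
[cite: Kraus1989, Prop. 2] [cite: SilvermanAEC2009, III.1 (b₂, b₄, b₆, b₈, c₄, c₆, Δ)] -/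
theorem sixteen_dvd_c₄_and_dvd_c₆_of_two_dvd (W : WeierstrassCurve ℤ) (h₄ : (2 : ℤ) ∣ W.c₄) (hΔ : (2 : ℤ) ∣ W.Δ) :
    (16 : ℤ) ∣ W.c₄ ∧ (32 : ℤ) ∣ W.c₆ := by
  obtain ⟨k, hk | hk⟩ := Int.even_or_odd' W.a₁
  · have hb₂ := KrausNecessity.b₂_of_even W hk
    have hb₄ := KrausNecessity.b₄_of_even W hk
    refine ⟨⟨(k ^ 2 + W.a₂) ^ 2 - 3 * (W.a₄ + k * W.a₃), ?_⟩, ?_⟩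
    · rw [KrausNecessity.c₄_eq, hb₂, hb₄]; ring
    obtain ⟨j, hj | hj⟩ := Int.even_or_odd' W.a₃
    · have hb₆ := KrausNecessity.b₆_of_even W hj
      refine ⟨-2 * (k ^ 2 + W.a₂) ^ 3 + 9 * (k ^ 2 + W.a₂) * (W.a₄ + k * W.a₃) - 27 * (j ^ 2 + W.a₆), ?_⟩
      rw [KrausNecessity.c₆_eq, hb₂, hb₄, hb₆]; ring
    · -- `a₃` odd ⟹ `Δ` odd: contradiction
      exfalso
      have hb₆ := KrausNecessity.b₆_of_odd W hj
      obtain ⟨w, hw⟩ := hΔ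
      have : W.Δ = 2 * (-8 * (k ^ 2 + W.a₂) ^ 2 * W.b₈ - 32 * (W.a₄ + k * W.a₃) ^ 3
          - 216 * (j ^ 2 + j + W.a₆) ^ 2 - 108 * (j ^ 2 + j + W.a₆)
          + 36 * (k ^ 2 + W.a₂) * (W.a₄ + k * W.a₃) * (4 * (j ^ 2 + j + W.a₆) + 1) - 14) + 1 := by
        rw [KrausNecessity.Δ_eq, hb₂, hb₄, hb₆]; ring
      omega
  · -- `a₁` odd ⟹ `c₄` odd: contradiction
    exfalso
    have hb₂ := KrausNecessity.b₂_of_odd W hk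
    obtain ⟨w, hw⟩ := h₄
    have : W.c₄ = 2 * (8 * (k ^ 2 + k + W.a₂) ^ 2 + 4 * (k ^ 2 + k + W.a₂) - 12 * W.b₄) + 1 := by
      rw [KrausNecessity.c₄_eq, hb₂]; ring
    omega

/-! ## Sufficiency (Kraus 1989, Props. 1–2; Cremona §3.2): the discharge of the named fact -/

namespace KrausSufficiency

/-- Shift identity for `T² − c₄` under `T ↦ T + m s`. [folklore] -/
private theorem sq_shift (T m s c₄ : ℤ) :
    (T + m * s) ^ 2 - c₄ = (T ^ 2 - c₄) + m * (s * (2 * T + m * s)) := by ring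

/-- Shift identity for Kraus's cubic `T³ − 3c₄T − 2c₆` under `T ↦ T + m s`. [folklore] -/
private theorem cubic_shift (T m s c₄ c₆ : ℤ) :
    (T + m * s) ^ 3 - 3 * c₄ * (T + m * s) - 2 * c₆
      = (T ^ 3 - 3 * c₄ * T - 2 * c₆) + m * (s * (3 * T ^ 2 + 3 * T * m * s + m ^ 2 * s ^ 2 - 3 * c₄)) := by
  ring

/-- Divisibility transfer along the shift `T ↦ T + m s` for `T² − c₄` (any `k ∣ m`). [folklore] -/
private theorem dvd_sq_shift {k T m s c₄ : ℤ} (hk : k ∣ m) (h : k ∣ T ^ 2 - c₄) :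
    k ∣ (T + m * s) ^ 2 - c₄ := by
  rw [sq_shift]; exact dvd_add h (dvd_mul_of_dvd_left hk _)

/-- Divisibility transfer along the shift `T ↦ T + m s` for `T³ − 3c₄T − 2c₆` (any `k ∣ m`). [folklore] -/
private theorem dvd_cubic_shift {k T m s c₄ c₆ : ℤ} (hk : k ∣ m) (h : k ∣ T ^ 3 - 3 * c₄ * T - 2 * c₆) :
    k ∣ (T + m * s) ^ 3 - 3 * c₄ * (T + m * s) - 2 * c₆ := by
  rw [cubic_shift]; exact dvd_add h (dvd_mul_of_dvd_left hk _)

/-- **The unit root** (the heart of Kraus's Props. 1–2): if `c₄` is invertible modulo `M`, `v c₄ ≡ 1 (mod M)`, and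
`c₄³ ≡ c₆² (mod M)`, then `t = −c₆ v` (i.e. `t ≡ −c₆/c₄`) satisfies `t² ≡ c₄` and `t³ − 3c₄t − 2c₆ ≡ 0 (mod M)`:
indeed `c₄³·(t³ − 3c₄t − 2c₆) ≡ c₆(c₄³ − c₆²)`. [cite: Kraus1989, Props. 1–2 (proof)] -/
theorem unit_root {M u v d c₄ c₆ : ℤ} (hv : v * c₄ = 1 - M * u) (hd : c₄ ^ 3 = c₆ ^ 2 + M * d) :
    M ∣ (-c₆ * v) ^ 2 - c₄ ∧ M ∣ (-c₆ * v) ^ 3 - 3 * c₄ * (-c₆ * v) - 2 * c₆ := by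
  refine ⟨⟨c₄ * (M * u ^ 2 - 2 * u) - d * v ^ 2, ?_⟩, ⟨c₆ * (d * v ^ 3 - 3 * M * u ^ 2 + M ^ 2 * u ^ 3), ?_⟩⟩
  · linear_combination (c₄ * (v * c₄ + 1 - M * u)) * hv + (-v ^ 2) * hd
  · linear_combination (c₆ * (3 - (v * c₄) ^ 2 - (v * c₄) * (1 - M * u) - (1 - M * u) ^ 2)) * hv
      + (c₆ * v ^ 3) * hd

/-- **Kraus at `p = 3`, sufficiency of the residue condition** (Kraus 1989, Prop. 1): if `27 ∣ c₄³ − c₆²` and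
`ord₃(c₆) ≠ 2`, there is an integer `t` with `t² ≡ c₄ (mod 3)` and `t³ − 3c₄t − 2c₆ ≡ 0 (mod 27)` — namely `t = 0`
when `3 ∣ c₆` (then `27 ∣ c₆` and `3 ∣ c₄`), and `t ≡ −c₆/c₄ (mod 27)` when `3 ∤ c₆`. [cite: Kraus1989, Prop. 1] -/
theorem three_adic_root {c₄ c₆ : ℤ} (h27 : (27 : ℤ) ∣ c₄ ^ 3 - c₆ ^ 2) (hv3 : padicValInt 3 c₆ ≠ 2) :
    ∃ t : ℤ, (3 : ℤ) ∣ t ^ 2 - c₄ ∧ (27 : ℤ) ∣ t ^ 3 - 3 * c₄ * t - 2 * c₆ := by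
  obtain ⟨e, he⟩ := h27
  by_cases h3 : (3 : ℤ) ∣ c₆
  · -- `3 ∣ c₆`: then `3 ∣ c₄`, `9 ∣ c₆`, and `ord₃ c₆ ≠ 2` forces `27 ∣ c₆`; take `t = 0`.
    obtain ⟨m, hm⟩ := h3
    have h3c₄ : (3 : ℤ) ∣ c₄ := by
      refine Int.prime_three.dvd_of_dvd_pow (n := 3) ⟨3 * m ^ 2 + 9 * e, ?_⟩
      linear_combination he + (c₆ + 3 * m) * hm
    obtain ⟨n, hn⟩ := h3c₄
    have h9m : (9 : ℤ) * m ^ 2 = 9 * (3 * (n ^ 3 - e)) := by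
      linear_combination (-1) * he - (c₆ + 3 * m) * hm + (c₄ ^ 2 + 3 * n * c₄ + 9 * n ^ 2) * hn
    have h3m : (3 : ℤ) ∣ m :=
      Int.prime_three.dvd_of_dvd_pow (n := 2) ⟨n ^ 3 - e, mul_left_cancel₀ (by norm_num) h9m⟩
    obtain ⟨m', hm'⟩ := h3m
    have h9 : ((3 : ℕ) : ℤ) ^ 2 ∣ c₆ := ⟨m', by rw [hm, hm']; push_cast; ring⟩
    have h27c₆ : (27 : ℤ) ∣ c₆ := by
      rcases (padicValInt_dvd_iff 2 c₆).mp h9 with h0 | h2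
      · rw [h0]; exact dvd_zero _
      · have h3' : ((3 : ℕ) : ℤ) ^ 3 ∣ c₆ :=
          (padicValInt_dvd_iff (p := 3) 3 c₆).mpr (Or.inr (by omega))
        norm_num at h3'
        exact h3'
    obtain ⟨w, hw⟩ := h27c₆
    exact ⟨0, ⟨-n, by rw [hn]; ring⟩, ⟨-2 * w, by rw [hw]; ring⟩⟩
  · -- `3 ∤ c₆`: then `3 ∤ c₄`, so `c₄` is a unit mod `27`; take `t ≡ −c₆ / c₄`.
    have h3c₄ : ¬ (3 : ℤ) ∣ c₄ := by
      rintro ⟨n, hn⟩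
      refine h3 (Int.prime_three.dvd_of_dvd_pow (n := 2) ⟨9 * n ^ 3 - 9 * e, ?_⟩)
      linear_combination (-1) * he + (c₄ ^ 2 + 3 * n * c₄ + 9 * n ^ 2) * hn
    have hcop : IsCoprime (3 : ℤ) c₄ := by
      have h12 : c₄ % 3 = 1 ∨ c₄ % 3 = 2 := by omega
      rcases h12 with h1 | h2
      · exact ⟨-(c₄ / 3), 1, by omega⟩
      · exact ⟨c₄ / 3 + 1, -1, by omega⟩
    obtain ⟨u, v, huv⟩ := hcop.pow_left (m := 3)
    have hv : v * c₄ = 1 - 27 * u := by linear_combination huv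
    have hd : c₄ ^ 3 = c₆ ^ 2 + 27 * e := by linear_combination he
    obtain ⟨hA, hB⟩ := unit_root hv hd
    exact ⟨-c₆ * v, dvd_trans ⟨9, by norm_num⟩ hA, hB⟩

/-- **Kraus at `p = 2`, the odd branch** (Kraus 1989, Prop. 2, case `c₆ ≡ −1 (mod 4)`): if `64 ∣ c₄³ − c₆²` and
`c₆ ≡ −1 (mod 4)`, then `c₄ ≡ 1 (mod 4)` is odd, and `t ≡ −c₆/c₄ (mod 64)` satisfies `t ≡ 1 (mod 4)`,
`t² ≡ c₄ (mod 64)`, `t³ − 3c₄t − 2c₆ ≡ 0 (mod 64)` (so `b₂ = t`, `a₁ = 1`). [cite: Kraus1989, Prop. 2] -/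
theorem two_adic_root_odd {c₄ c₆ : ℤ} (h64 : (64 : ℤ) ∣ c₄ ^ 3 - c₆ ^ 2) (hc₆ : c₆ ≡ -1 [ZMOD 4]) :
    ∃ t : ℤ, (∃ q : ℤ, t = 4 * q + 1) ∧ (64 : ℤ) ∣ t ^ 2 - c₄ ∧ (64 : ℤ) ∣ t ^ 3 - 3 * c₄ * t - 2 * c₆ := by
  obtain ⟨d, hd⟩ := h64
  have hd' : c₄ ^ 3 = c₆ ^ 2 + 64 * d := by linear_combination hd
  have h4 : c₆ % 4 = 3 := by unfold Int.ModEq at hc₆; omega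
  obtain ⟨f, hf⟩ : ∃ f, c₆ = 4 * f + 3 := ⟨c₆ / 4, by omega⟩
  -- `c₄` is odd
  have hodd : Odd c₄ := by
    have h3 : Odd (c₄ ^ 3) := by
      rw [hd']
      exact (show Odd c₆ from ⟨2 * f + 1, by omega⟩).pow.add_even ⟨32 * d, by ring⟩
    exact (Int.odd_pow' (by norm_num)).mp h3
  obtain ⟨g, hg⟩ := hodd
  -- `c₄ ≡ 1 (mod 4)`
  have h6g : 6 * g = 4 * (16 * d + 2 + 4 * f ^ 2 + 6 * f - 2 * g ^ 3 - 3 * g ^ 2) := by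
    have h := hd'
    rw [hg, hf] at h
    linear_combination h
  obtain ⟨K, hK⟩ : ∃ K, 6 * g = 4 * K := ⟨_, h6g⟩
  obtain ⟨h, hh⟩ : ∃ h, g = 2 * h := ⟨g / 2, by omega⟩
  -- a unit inverse of `c₄` modulo `64`
  have hcop : IsCoprime (2 : ℤ) c₄ := ⟨-g, 1, by rw [hg]; ring⟩
  obtain ⟨u, v, huv⟩ := hcop.pow_left (m := 6)
  have hv : v * c₄ = 1 - 64 * u := by linear_combination huv
  obtain ⟨hA, hB⟩ := unit_root hv hd'
  refine ⟨-c₆ * v, ?_, hA, hB⟩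
  -- `v ≡ 1 (mod 4)` and `t = −c₆ v ≡ 1 (mod 4)`
  obtain ⟨m, hm⟩ : ∃ m, v = 4 * m + 1 := by
    refine ⟨-16 * u - h * v, ?_⟩
    rw [hg, hh] at hv
    linear_combination hv
  exact ⟨-4 * f * m - f - 3 * m - 1, by rw [hf, hm]; ring⟩

/-- Assembly, branch `a₁ = 1, a₃ = 0` (Cremona §3.2 reconstruction: `a₄ = (b₂² − c₄)/48`,
`a₆ = (b₂³ − 3c₄b₂ − 2c₆)/1728` with `b₂ = 4a₂ + 1`). [cite: Cremona1997Algorithms, §3.2 (lines 17–23)] -/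
theorem assemble_one_zero {a₂ a₄ a₆ c₄ c₆ : ℤ} (h₄ : (4 * a₂ + 1) ^ 2 - c₄ = 48 * a₄)
    (h₆ : (4 * a₂ + 1) ^ 3 - 3 * c₄ * (4 * a₂ + 1) - 2 * c₆ = 1728 * a₆) :
    ∃ W : WeierstrassCurve ℤ, W.c₄ = c₄ ∧ W.c₆ = c₆ := by
  refine ⟨⟨1, a₂, 0, a₄, a₆⟩, ?_, ?_⟩
  · simp only [WeierstrassCurve.c₄, WeierstrassCurve.b₂, WeierstrassCurve.b₄]
    linear_combination h₄
  · simp only [WeierstrassCurve.c₆, WeierstrassCurve.b₂, WeierstrassCurve.b₄, WeierstrassCurve.b₆]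
    have h2 : (2 : ℤ) * (-(4 * a₂ + 1) ^ 3 + 36 * (4 * a₂ + 1) * (2 * a₄) - 216 * (4 * a₆)) = 2 * c₆ := by
      linear_combination (-3 * (4 * a₂ + 1)) * h₄ + h₆
    have h2' := mul_left_cancel₀ (two_ne_zero) h2
    linear_combination h2'

/-- Assembly, branch `a₁ = 0, a₃ = 0` (`b₂ = 4a₂`). [cite: Cremona1997Algorithms, §3.2 (lines 17–23)] -/
theorem assemble_zero_zero {a₂ a₄ a₆ c₄ c₆ : ℤ} (h₄ : (4 * a₂) ^ 2 - c₄ = 48 * a₄)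
    (h₆ : (4 * a₂) ^ 3 - 3 * c₄ * (4 * a₂) - 2 * c₆ = 1728 * a₆) :
    ∃ W : WeierstrassCurve ℤ, W.c₄ = c₄ ∧ W.c₆ = c₆ := by
  refine ⟨⟨0, a₂, 0, a₄, a₆⟩, ?_, ?_⟩
  · simp only [WeierstrassCurve.c₄, WeierstrassCurve.b₂, WeierstrassCurve.b₄]
    linear_combination h₄
  · simp only [WeierstrassCurve.c₆, WeierstrassCurve.b₂, WeierstrassCurve.b₄, WeierstrassCurve.b₆]
    have h2 : (2 : ℤ) * (-(4 * a₂) ^ 3 + 36 * (4 * a₂) * (2 * a₄) - 216 * (4 * a₆)) = 2 * c₆ := by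
      linear_combination (-3 * (4 * a₂)) * h₄ + h₆
    have h2' := mul_left_cancel₀ (two_ne_zero) h2
    linear_combination h2'

/-- Assembly, branch `a₁ = 0, a₃ = 1` (`b₂ = 4a₂`, `b₆ = 4a₆ + 1`). [cite: Cremona1997Algorithms, §3.2 (lines 17–23)] -/
theorem assemble_zero_one {a₂ a₄ a₆ c₄ c₆ : ℤ} (h₄ : (4 * a₂) ^ 2 - c₄ = 48 * a₄)
    (h₆ : (4 * a₂) ^ 3 - 3 * c₄ * (4 * a₂) - 2 * c₆ = 1728 * a₆ + 432) :
    ∃ W : WeierstrassCurve ℤ, W.c₄ = c₄ ∧ W.c₆ = c₆ := by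
  refine ⟨⟨0, a₂, 1, a₄, a₆⟩, ?_, ?_⟩
  · simp only [WeierstrassCurve.c₄, WeierstrassCurve.b₂, WeierstrassCurve.b₄]
    linear_combination h₄
  · simp only [WeierstrassCurve.c₆, WeierstrassCurve.b₂, WeierstrassCurve.b₄, WeierstrassCurve.b₆]
    have h2 : (2 : ℤ) * (-(4 * a₂) ^ 3 + 36 * (4 * a₂) * (2 * a₄) - 216 * (1 + 4 * a₆)) = 2 * c₆ := by
      linear_combination (-3 * (4 * a₂)) * h₄ + h₆
    have h2' := mul_left_cancel₀ (two_ne_zero) h2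
    linear_combination h2'

end KrausSufficiency

open KrausSufficiency in
/-- **Kraus's conditions are SUFFICIENT** (Kraus 1989, Props. 1–2, sufficiency; Cremona §3.2, the Laska–Kraus–Connell
reconstruction): if `1728 ∣ c₄³ − c₆²` and `(c₄, c₆)` satisfies Kraus's conditions, there is an INTEGER Weierstrass
equation with invariants `c₄, c₆`.  Proof (following Kraus/Cremona): it suffices to find `b₂ ∈ ℤ` with
`24 ∣ b₂² − c₄`, `b₂³ − 3c₄b₂ − 2c₆ ≡ 0` or `432 (mod 1728)`, `b₂ ≡ 0, 1 (mod 4)` and `b₄` even; the residue of `b₂`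
mod `27` is `0` or `−c₆/c₄` (Prop. 1), mod `64` it is `−c₆/c₄` with `a₁ = 1` when `c₆ ≡ −1 (mod 4)` and `0` with
`a₁ = 0` otherwise (Prop. 2), glued by the Chinese remainder theorem (`1216 ≡ 1 (mod 27)`, `≡ 0 (mod 64)`); then
`a₄ = (b₂² − c₄)/48`, `a₆ = (b₂³ − 3c₄b₂ − 2c₆ − 432a₃)/1728`.
[cite: Kraus1989, Props. 1–2] [cite: Cremona1997Algorithms, §3.2 (p. 51, lines 10–23)]
[cite: Fisher2007MinimisingQuarticsCubics, Thm. 2.8] -/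
theorem exists_integralWeierstrass_of_krausConditions {c₄ c₆ : ℤ} (h1728 : (1728 : ℤ) ∣ c₄ ^ 3 - c₆ ^ 2)
    (hK : KrausConditions c₄ c₆) : ∃ W : WeierstrassCurve ℤ, W.c₄ = c₄ ∧ W.c₆ = c₆ := by
  obtain ⟨hv3, h2⟩ := hK
  have h27 : (27 : ℤ) ∣ c₄ ^ 3 - c₆ ^ 2 := dvd_trans ⟨64, by norm_num⟩ h1728
  have h64 : (64 : ℤ) ∣ c₄ ^ 3 - c₆ ^ 2 := dvd_trans ⟨27, by norm_num⟩ h1728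
  have hcop64_27 : IsCoprime (64 : ℤ) 27 := Int.isCoprime_iff_gcd_eq_one.mpr (by norm_num)
  have hcop64_3 : IsCoprime (64 : ℤ) 3 := Int.isCoprime_iff_gcd_eq_one.mpr (by norm_num)
  have hcop16_3 : IsCoprime (16 : ℤ) 3 := Int.isCoprime_iff_gcd_eq_one.mpr (by norm_num)
  obtain ⟨t₃, h3a, h3b⟩ := three_adic_root h27 hv3
  rcases h2 with hc₆ | ⟨h16, hc₆⟩
  · -- Case `c₆ ≡ −1 (mod 4)`: `a₁ = 1`, `a₃ = 0`.
    obtain ⟨t₂, ⟨q, hq⟩, h2a, h2b⟩ := two_adic_root_odd h64 hc₆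
    -- CRT: `b₂ ≡ t₂ (mod 64)`, `b₂ ≡ t₃ (mod 27)`
    have hcrt : t₂ + 64 * (19 * (t₃ - t₂)) = t₃ + 27 * (45 * (t₃ - t₂)) := by ring
    have hA64 : (64 : ℤ) ∣ (t₂ + 64 * (19 * (t₃ - t₂))) ^ 2 - c₄ := dvd_sq_shift dvd_rfl h2a
    have hA3 : (3 : ℤ) ∣ (t₂ + 64 * (19 * (t₃ - t₂))) ^ 2 - c₄ := by
      rw [hcrt]; exact dvd_sq_shift ⟨9, by norm_num⟩ h3a
    have hB64 : (64 : ℤ) ∣ (t₂ + 64 * (19 * (t₃ - t₂))) ^ 3 - 3 * c₄ * (t₂ + 64 * (19 * (t₃ - t₂))) - 2 * c₆ :=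
      dvd_cubic_shift dvd_rfl h2b
    have hB27 : (27 : ℤ) ∣ (t₂ + 64 * (19 * (t₃ - t₂))) ^ 3 - 3 * c₄ * (t₂ + 64 * (19 * (t₃ - t₂))) - 2 * c₆ := by
      rw [hcrt]; exact dvd_cubic_shift dvd_rfl h3b
    have h48 : (48 : ℤ) ∣ (t₂ + 64 * (19 * (t₃ - t₂))) ^ 2 - c₄ :=
      dvd_trans ⟨4, by norm_num⟩ (hcop64_3.mul_dvd hA64 hA3)
    obtain ⟨a₄, ha₄⟩ := h48
    obtain ⟨a₆, ha₆⟩ := hcop64_27.mul_dvd hB64 hB27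
    have hb : t₂ + 64 * (19 * (t₃ - t₂)) = 4 * (q + 16 * (19 * (t₃ - t₂))) + 1 := by rw [hq]; ring
    rw [hb] at ha₄ ha₆
    exact assemble_one_zero (a₆ := a₆) ha₄ (by linear_combination ha₆)
  · -- Case `16 ∣ c₄`, `c₆ ≡ 0, 8 (mod 32)`: `a₁ = 0`, `b₂ = 1216 t₃ = 4·(304 t₃)`.
    have h16' : (16 : ℤ) ∣ c₄ := by norm_num at h16; exact h16
    have hcrt : (4 : ℤ) * (304 * t₃) = t₃ + 27 * (45 * t₃) := by ring
    have hA3 : (3 : ℤ) ∣ (4 * (304 * t₃)) ^ 2 - c₄ := by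
      rw [hcrt]; exact dvd_sq_shift ⟨9, by norm_num⟩ h3a
    have hA16 : (16 : ℤ) ∣ (4 * (304 * t₃)) ^ 2 - c₄ := dvd_sub ⟨92416 * t₃ ^ 2, by ring⟩ h16'
    have hB27 : (27 : ℤ) ∣ (4 * (304 * t₃)) ^ 3 - 3 * c₄ * (4 * (304 * t₃)) - 2 * c₆ := by
      rw [hcrt]; exact dvd_cubic_shift dvd_rfl h3b
    have hB64' : (64 : ℤ) ∣ (4 * (304 * t₃)) ^ 3 - 3 * c₄ * (4 * (304 * t₃)) - 2 * c₆ + 2 * c₆ :=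
      ⟨19 * t₃ * ((4 * (304 * t₃)) ^ 2 - 3 * c₄), by ring⟩
    obtain ⟨a₄, ha₄⟩ := hcop16_3.mul_dvd hA16 hA3
    rcases hc₆ with h0 | h8
    · -- `c₆ ≡ 0 (mod 32)`: `a₃ = 0`
      have h32 : (32 : ℤ) ∣ c₆ := Int.modEq_zero_iff_dvd.mp h0
      have hB64 : (64 : ℤ) ∣ (4 * (304 * t₃)) ^ 3 - 3 * c₄ * (4 * (304 * t₃)) - 2 * c₆ := by
        have h2c : (64 : ℤ) ∣ 2 * c₆ := by
          obtain ⟨w, hw⟩ := h32; exact ⟨w, by rw [hw]; ring⟩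
        have h := dvd_sub hB64' h2c
        rwa [add_sub_cancel_right] at h
      obtain ⟨a₆, ha₆⟩ := hcop64_27.mul_dvd hB64 hB27
      exact assemble_zero_zero (a₂ := 304 * t₃) (a₄ := a₄) (a₆ := a₆)
        (by linear_combination ha₄) (by linear_combination ha₆)
    · -- `c₆ ≡ 8 (mod 32)`: `a₃ = 1`
      have h32 : (32 : ℤ) ∣ 8 - c₆ := Int.modEq_iff_dvd.mp h8
      have hB64 : (64 : ℤ) ∣ (4 * (304 * t₃)) ^ 3 - 3 * c₄ * (4 * (304 * t₃)) - 2 * c₆ - 432 := by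
        obtain ⟨w, hw⟩ := h32
        obtain ⟨w', hw'⟩ := hB64'
        exact ⟨w' + w - 7, by linear_combination hw' + 2 * hw⟩
      have hB27' : (27 : ℤ) ∣ (4 * (304 * t₃)) ^ 3 - 3 * c₄ * (4 * (304 * t₃)) - 2 * c₆ - 432 :=
        dvd_sub hB27 ⟨16, by norm_num⟩
      obtain ⟨a₆, ha₆⟩ := hcop64_27.mul_dvd hB64 hB27'
      exact assemble_zero_one (a₂ := 304 * t₃) (a₄ := a₄) (a₆ := a₆)
        (by linear_combination ha₄) (by linear_combination ha₆)

/-- **Discharge of the named fact** `exists_integralWeierstrass_iff_krausConditions` (Fisher 2007, Thm. 2.8 ⟸ Kraus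
1989, Props. 1–2): necessity is `krausConditions_of_int`, sufficiency is
`exists_integralWeierstrass_of_krausConditions` (the hypothesis `c₄³ ≠ c₆²` is not needed for either direction).
[cite: Fisher2007MinimisingQuarticsCubics, Thm. 2.8] [cite: Kraus1989, Props. 1–2] -/
theorem exists_integralWeierstrass_iff_krausConditions_holds : exists_integralWeierstrass_iff_krausConditions := by
  intro c₄ c₆ h1728 _hne
  constructor
  · rintro ⟨W, h₄, h₆⟩
    rw [← h₄, ← h₆]
    exact krausConditions_of_int W
  · exact exists_integralWeierstrass_of_krausConditions h1728

end Literature.NumberTheory.EllipticCurves
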